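import Summits.Ventures.HodgeRepro2.A2HodgeSymmetry
import Summits.Ventures.HodgeRepro2.A2PontryaginLeibniz

/-!
# A2PontryaginConjugation — the Pontryagin product commutes with the swap `a_p ↔ b_p` up to the
orientation sign `(−1)^n`

Tier-4 annex of sub-claim A2 (seat p6, cell pub-hodge-repro2); §8(d): uses an L-value-free
non-vanishing device: NO.

The swap `swapA` of row 127 (the linear part of complex conjugation in the eigenform basis) is an
algebra involution of the model.  It reverses the orientation of every plane (`E_p ↦ −E_p`), so
`∫_B ∘ swapA = (−1)^n ∫_B`, `n = |ι|` (`integral_swapA`), and it is compatible with the Pontryagin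
product up to that sign:

  `swapA (z ⋆ x) = (−1)^n • (swapA z ⋆ swapA x)`   (`swapA_pontryagin`),

exactly for the twelve planes (`swapA_pontryagin_twelve`, `n = 12`).  The proof lifts `swapA` to the
graded tensor square (`swapAA = swapA ⊗ swapA`, Mathlib's `GradedTensorProduct.lift`), shows
`Δ ∘ swapA = swapAA ∘ Δ` on the generators and `II ∘ swapAA = II` (two orientation signs
cancel), and reads the characterising identity of row 92.

In the prose: the Pontryagin product `m_*` is defined over `ℚ`, hence commutes with complex
conjugation; the model sees the linear part of that statement.  What stays prose: the antilinear
part and the identification with `H^*(B, ℂ)`; not on the N1 chain.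
-/

namespace Summit.Ventures.HodgeRepro2.A2PontryaginConjugation

open WeilPlanes WeilIntegral WeilCoproduct WeilPairing A2ModelDuality A2PontryaginModel
  A2HodgeSymmetry

variable {ι : Type*} [DecidableEq ι] [Fintype ι]

omit [Fintype ι] in
/-- `swapA` preserves the degree. -/
theorem swapA_mem_grading {i : ℕ} {x : A ι} (hx : x ∈ grading ι i) : swapA x ∈ grading ι i := by
  refine Submodule.pow_induction_on_left' (LinearMap.range (ExteriorAlgebra.ι ℂ : V ι →ₗ[ℂ] A ι))
    (C := fun n x _ => swapA x ∈ grading ι n) ?_ ?_ ?_ hx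
  · intro r
    rw [AlgHom.commutes]
    exact Submodule.algebraMap_mem r
  · intro x y n _ _ hx hy
    rw [map_add]
    exact Submodule.add_mem _ hx hy
  · rintro m ⟨v, rfl⟩ n x _ hx
    rw [map_mul]
    have h1 : swapA (ExteriorAlgebra.ι ℂ v) ∈ grading ι 1 := by
      show ExteriorAlgebra.map swapV.toLinearMap (ExteriorAlgebra.ι ℂ v) ∈ grading ι 1
      rw [ExteriorAlgebra.map_apply_ι]
      exact ι_mem_one _
    have := SetLike.mul_mem_graded h1 hx
    rwa [add_comm] at this

omit [Fintype ι] in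
/-- The anticommutation of `inl ∘ swapA` and `inr ∘ swapA` in the graded tensor square. -/
theorem inl_swapA_mul_inr_swapA {i j : ℕ} (a : grading ι i) (b : grading ι j) :
    (inl.comp swapA) (a : A ι) * (inr.comp swapA) (b : A ι) =
      (-1 : ℤˣ) ^ (j * i) • ((inr.comp swapA) (b : A ι) * (inl.comp swapA) (a : A ι)) := by
  simp only [AlgHom.comp_apply]
  have h := GradedTensorProduct.tmul_coe_mul_coe_tmul (grading ι) (grading ι) (1 : A ι)
    ⟨swapA b, swapA_mem_grading b.2⟩ ⟨swapA a, swapA_mem_grading a.2⟩ (1 : A ι)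
  simp only [one_mul, mul_one] at h
  have hl : inr (swapA (b : A ι)) * inl (swapA (a : A ι)) =
      (-1 : ℤˣ) ^ (j * i) • (inl (swapA (a : A ι)) * inr (swapA (b : A ι))) := by
    rw [inl_mul_inr]
    show (1 : A ι) ᵍ⊗ₜ[ℂ] (swapA (b : A ι)) * (swapA (a : A ι)) ᵍ⊗ₜ[ℂ] (1 : A ι) = _
    exact h
  rw [hl, smul_smul, Int.units_mul_self, one_smul]

/-- `swapA ⊗ swapA` on the graded tensor square. -/
noncomputable def swapAA : AA ι →ₐ[ℂ] AA ι :=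
  GradedTensorProduct.lift (grading ι) (grading ι) (inl.comp swapA) (inr.comp swapA)
    fun _ _ a b => inl_swapA_mul_inr_swapA a b

omit [Fintype ι] in
/-- `swapAA (a ⊗ b) = inl (swapA a) · inr (swapA b)`. -/
theorem swapAA_tmul (a b : A ι) : swapAA (a ᵍ⊗ₜ[ℂ] b) = inl (swapA a) * inr (swapA b) := rfl

omit [Fintype ι] in
/-- `swapAA (inl a) = inl (swapA a)`. -/
theorem swapAA_inl (a : A ι) : swapAA (inl a) = inl (swapA a) := by
  rw [show inl a = a ᵍ⊗ₜ[ℂ] (1 : A ι) from rfl, swapAA_tmul, map_one, map_one, mul_one]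

omit [Fintype ι] in
/-- `swapAA (inr b) = inr (swapA b)`. -/
theorem swapAA_inr (b : A ι) : swapAA (inr b) = inr (swapA b) := by
  rw [show inr b = (1 : A ι) ᵍ⊗ₜ[ℂ] b from rfl, swapAA_tmul, map_one, map_one, one_mul]

omit [Fintype ι] in
/-- The coproduct commutes with the swap: `Δ (swapA x) = swapAA (Δ x)`. -/
theorem cop_swapA (x : A ι) : cop (swapA x) = swapAA (cop x) := by
  have h : (cop.comp swapA : A ι →ₐ[ℂ] AA ι) = swapAA.comp cop := by
    refine ExteriorAlgebra.hom_ext (LinearMap.ext fun v => ?_)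
    simp only [LinearMap.comp_apply, AlgHom.toLinearMap_apply, AlgHom.comp_apply]
    have hv : swapA (ExteriorAlgebra.ι ℂ v) = ExteriorAlgebra.ι ℂ (swapV v) := by
      show ExteriorAlgebra.map swapV.toLinearMap (ExteriorAlgebra.ι ℂ v) = _
      rw [ExteriorAlgebra.map_apply_ι, LinearEquiv.coe_coe]
    rw [hv, cop_ι, cop_ι, map_add, swapAA_inl, swapAA_inr, hv]
  exact AlgHom.congr_fun h x

omit [Fintype ι] in
/-- `swapA (E_T) = (−1)^{|T|} E_T`. -/
theorem swapA_ET (T : Finset ι) : swapA (ET T) = (-1 : ℂ) ^ T.card • ET T := by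
  induction T using Finset.induction_on with
  | empty => simp [WeilPlanes.ET_empty]
  | insert p T hp ih =>
    rw [ET_insert hp, map_mul, swapA_E, ih, Finset.card_insert_of_notMem hp, neg_mul, mul_smul_comm,
      ← neg_smul, pow_succ, mul_neg_one]

omit [DecidableEq ι] in
/-- `(genList.map enum).toFinset = univ`. -/
theorem toFinset_map_enum_genList :
    ((genList : List (Gen ι)).map enum).toFinset = Finset.univ := by
  ext i
  obtain ⟨j, rfl⟩ := enum.surjective i
  simp [genList, mem_planeList]

/-- THE ORIENTATION SIGN: `∫_B (swapA y) = (−1)^n ∫_B y` (every plane is reversed). -/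
theorem integral_swapA (y : A ι) : integral (swapA y) = (-1 : ℂ) ^ Fintype.card ι * integral y := by
  have hlin : (integral ∘ₗ swapA.toLinearMap : A ι →ₗ[ℂ] ℂ) = (-1 : ℂ) ^ Fintype.card ι • integral := by
    refine aBasis.ext fun s => ?_
    rw [LinearMap.comp_apply, AlgHom.toLinearMap_apply, LinearMap.smul_apply, smul_eq_mul]
    by_cases hs : s = Finset.univ
    · subst hs
      -- `aBasis univ = ε • E_univ` and `swapA E_univ = (−1)^n E_univ`
      obtain ⟨ε, hε, h⟩ := A2HodgeBigrading.exists_sign_mono_eq_aBasis (l := genList)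
        (nodup_planeList (Finset.univ : Finset ι))
      rw [toFinset_map_enum_genList] at h
      have hsq : ε * ε = 1 := by rcases hε with rfl | rfl <;> norm_num
      have hET : ET (Finset.univ : Finset ι) = mono genList := ET_eq_mono _
      have hb : aBasis (Finset.univ : Finset (Fin (Fintype.card (Gen ι)))) = ε • ET Finset.univ := by
        rw [hET, h, smul_smul, hsq, one_smul]
      rw [hb, map_smul, swapA_ET, map_smul, map_smul, smul_eq_mul, smul_eq_mul, map_smul,
        smul_eq_mul, Finset.card_univ]
      ring
    · have hne : ∃ j, j ∉ (genListOf s).map swapGen := by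
        have : ∃ j, j ∉ genListOf s := by
          by_contra hcon
          apply hs
          ext i
          obtain ⟨j, rfl⟩ := enum.surjective i
          simp only [Finset.mem_univ, iff_true]
          by_contra hj
          exact hcon ⟨j, fun h => hj ((mem_genListOf _ _).mp h)⟩
        obtain ⟨j, hj⟩ := this
        refine ⟨swapGen j, fun hmem => hj ?_⟩
        rw [List.mem_map] at hmem
        obtain ⟨k, hk, hkj⟩ := hmem
        rwa [swapGen.injective hkj] at hk
      rw [aBasis_apply, swapA_mono, integral_mono_eq_zero (Or.inr hne),
        integral_mono_eq_zero (Or.inr ?_), mul_zero]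
      obtain ⟨j, hj⟩ := hne
      refine ⟨swapGen j, fun h => hj ?_⟩
      rw [List.mem_map]
      exact ⟨swapGen j, h, swapGen_swapGen j⟩
  have := LinearMap.congr_fun hlin y
  rwa [LinearMap.comp_apply, AlgHom.toLinearMap_apply, LinearMap.smul_apply, smul_eq_mul] at this

/-- `II ∘ swapAA = II`: the two orientation signs cancel. -/
theorem II_swapAA (Y : AA ι) : II (swapAA Y) = II Y := by
  refine AA_induction (motive := fun Y => II (swapAA Y) = II Y) ?_ ?_ ?_ Y
  · rw [map_zero, map_zero]
  · intro x y
    rw [swapAA_tmul, inl_mul_inr, II_tmul, II_tmul, integral_swapA, integral_swapA]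
    have hsq : ((-1 : ℂ) ^ Fintype.card ι) * (-1 : ℂ) ^ Fintype.card ι = 1 := by
      rw [← pow_add, ← two_mul, pow_mul, neg_one_sq, one_pow]
    calc (-1 : ℂ) ^ Fintype.card ι * integral x * ((-1 : ℂ) ^ Fintype.card ι * integral y)
        = ((-1 : ℂ) ^ Fintype.card ι * (-1 : ℂ) ^ Fintype.card ι) * (integral x * integral y) := by
          ring
      _ = integral x * integral y := by rw [hsq, one_mul]
  · intro Z Z' hZ hZ'
    rw [map_add, map_add, hZ, hZ', map_add]

/-- THE PONTRYAGIN PRODUCT COMMUTES WITH THE SWAP UP TO THE ORIENTATION SIGN: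
`swapA (z ⋆ x) = (−1)^n • (swapA z ⋆ swapA x)`. -/
theorem swapA_pontryagin (z x : A ι) :
    swapA (pontryagin z x) = (-1 : ℂ) ^ Fintype.card ι • pontryagin (swapA z) (swapA x) := by
  have key : ∀ u, integral (swapA (pontryagin z x) * u) =
      integral (((-1 : ℂ) ^ Fintype.card ι • pontryagin (swapA z) (swapA x)) * u) := by
    intro u
    have h1 : swapA (pontryagin z x) * u = swapA (pontryagin z x * swapA u) := by
      rw [map_mul, swapA_swapA]
    rw [h1, integral_swapA, integral_pontryagin_mul, cop_swapA, smul_mul_assoc, map_smul,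
      smul_eq_mul, integral_pontryagin_mul, ← II_swapAA (inl (swapA z) * inr (swapA x) * cop u),
      map_mul swapAA, map_mul swapAA, swapAA_inl, swapAA_inr, swapA_swapA, swapA_swapA]
  have h0 := eq_zero_of_forall_integral_mul_eq_zero
    (x := swapA (pontryagin z x) - (-1 : ℂ) ^ Fintype.card ι • pontryagin (swapA z) (swapA x))
    (fun u => by rw [sub_mul, map_sub, key, sub_self])
  exact sub_eq_zero.mp h0

/-- THE TWELVE-PLANE INSTANCE: `swapA (z ⋆ x) = swapA z ⋆ swapA x` (`n = 12` is even). -/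
theorem swapA_pontryagin_twelve (z x : A A2TwelvePlanes.ι₁₂) :
    swapA (pontryagin z x) = pontryagin (swapA z) (swapA x) := by
  rw [swapA_pontryagin, A2TwelvePlanes.card_twelve]
  norm_num

/-- `swapA θ^k = (−1)^k θ^k`. -/
theorem swapA_theta_pow (c : ι → ℂ) (k : ℕ) : swapA (theta c ^ k) = (-1 : ℂ) ^ k • theta c ^ k := by
  rw [map_pow, swapA_theta, neg_pow, Algebra.smul_def, map_pow, map_neg, map_one]

end Summit.Ventures.HodgeRepro2.A2PontryaginConjugation
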